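import Summits.HubbardSuperconductivity.HubbardSuperconductivity.Theses.FluxSpectroscopy

/-!
# Birth skeleton (BC3) for crux `OverlapNondegeneracy` — stmt-HubbardSuperconductivity-1820
(route `FluxSpectroscopy`, rank 5; sub-problem `HubbardSuperconductivity`)

Planner `planner-skel-stmt-HubbardSuperconductivity-1820-0`, 2026-08-17 (skeleton-register, re-audit bin
REPAIRABLE). Published as `Cruxes/OverlapNondegeneracy/Lines/birth.lean`.

The crux: in every flux window `FC_T(U,δ) ∧ FC_K(U,δ)`, for every `c > 0` and every admissible sector
ground-state sequence `ψ_L` there is `c' > 0` such that, eventually in even `L`, EVERY unit eigenvector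
`v` of `ρ₂(ψ_L)` with eigenvalue `≥ c N_L` that is odd under the diagonal mirror `d4Act (sr 3)` has
nearest-neighbour `d`-wave weight `‖⟨v, φ_d⟩‖² ≥ c' L²` (`φ_d = pairFieldWavefunction dWaveFormFactor L`,
`‖φ_d‖² = 4L²`). It is a statement about the INTERNAL STRUCTURE of the Cooper-pair wavefunction, which
the route's energies cannot see. The skeleton cuts it along the three independent ways it can fail
(the crux's own `why it might fail` list: finite-momentum/extended pairs · higher angular harmonics ·
`s`-admixture), i.e. RADIAL CAPTURE × RADIAL SHELL SELECTION × ANGULAR SELECTION: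

* `stub_finiteRangeCapture : FiniteRangeCapture` — COMPACTNESS OF THE PAIR (zero-momentum, finite
  range): there are a FINITE set `S ⊂ ℤ²` of displacements and `c₁ > 0` such that eventually every
  macroscopic mirror-odd unit eigenvector keeps weight `Σ_{e ∈ S} ‖⟨v, β_{L,e}⟩‖² ≥ c₁ L²` on the
  zero-momentum singlet bond fields `β_{L,e} = Σ_x (c_{x↑}c_{x+e,↓} - c_{x↓}c_{x+e,↑})/√2`-wavefunctions
  (`‖β_{L,e}‖² = L²`, pairwise orthogonal for distinct `e mod L`, so this is `‖P_S v‖² ≥ c₁`: an `O(1)`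
  fraction of the condensate wavefunction sits on pairs of bounded size and zero centre-of-mass
  momentum). A necessary condition of the crux (crux ⇒ this with `S = unitSteps`, `c₁ = c'/4`, since
  `⟨v, φ_d⟩ = Σ_e g_d(e) ⟨v, β_{L,e}⟩` and Cauchy–Schwarz), strictly weaker than it. Where PDW /
  stripe-fragmented / quasi-long-range pairs fail. Hard (the physics; open).
* `stub_nearestNeighbourDominance : NearestNeighbourDominance` — THE FIRST HARMONIC IS PRESENT: for
  EVERY finite displacement set `S` there is `c₂ > 0` with, eventually,
  `c₂ Σ_{e ∈ S} ‖⟨v, β_{L,e}⟩‖² ≤ ‖⟨v, φ_{s'}⟩‖² + ‖⟨v, φ_d⟩‖²` for the same eigenvectors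
  (`φ_{s'} = pairFieldWavefunction extendedSWave L`, `‖φ_{s'}‖² = ‖φ_d‖² = 4L²`, `φ_{s'} ⟂ φ_d`;
  `span{φ_{s'}, φ_d}` = the singlet nearest-neighbour shell `span{β_{L,±e₁}, β_{L,±e₂}}` seen by an antisymmetric `v`): the nearest-neighbour shell carries a fixed fraction of any finite-range zero-momentum
  singlet weight — excludes pure higher-harmonic condensates (`A₂g` `g`-wave `xy(x²-y²)`, longer-range
  `B₁g` `cos 2k_x - cos 2k_y`), which are mirror-odd with ZERO nearest-neighbour weight. A necessary
  condition of the crux (crux ⇒ this with `c₂ = c'/|S|`), strictly weaker than it. Hard (open).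
* `stub_mirrorOddOrthogonalExtendedS : MirrorOddOrthogonalExtendedS` — ANGULAR SELECTION BY SYMMETRY
  (provable now, size M): a pair wavefunction odd under the diagonal mirror is orthogonal to the
  extended-`s` pair wavefunction, `⟨v, φ_{s'}⟩ = 0`, for every side `L ≥ 1`: `d4Act γ` preserves
  `star · ⬝ᵥ ·` (`d4Orb_bijective`, `Equiv.sum_comp`) and `φ_{s'}` is `D₄`-invariant (the proof of
  `pairFieldWavefunction_dWave_d4Orb` with `extendedSWave`, which is invariant under the `D₄` action on
  steps: `sum_steps_rotate`, `sum_steps_reflect`, `Torus.proj_rotate/reflect`), so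
  `⟨v, φ⟩ = ⟨γ•v, γ•φ⟩ = -⟨v, φ⟩`.

Composition `OverlapNondegeneracy_of` (hypotheses spelled `__Registered.stub_X`, `rfl`-aliases keyed
by the stub names, for the native audit) is proved below WITHOUT `sorry`: take `S, c₁` from capture,
`c₂` from dominance at that `S`, `c' := c₁ c₂`, intersect the two eventualities, kill the `s'` term by
the symmetry stub and chain the two inequalities. It concludes the route decl
`Summit.HubbardSuperconductivity.HubbardSuperconductivity.Theses.FluxSpectroscopy.OverlapNondegeneracy`
BY NAME. Sorries live only in the three `stub_*` theorems.

Conventions: the `let` preamble (`ET`, `EK`, `FCT`, `FCK`, `Hyp`) of the two conditional stubs is the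
crux's, verbatim (route file `Theses/FluxSpectroscopy.lean`, item stmt-HubbardSuperconductivity-1820),
so that the flux hypotheses are passed through unchanged; `bond L e` is the `e`-step component of
`pairFieldWavefunction` with unit form factor (cf. `pairFieldWavefunction_eq_sum_step`).

Disproof used: none relevant (no `Cruxes/OverlapNondegeneracy/Disproof.lean`, no landed Negative lemma,
`ledger crux ls` empty on 2026-08-17). Refuter note honoured (items 1819/1820, 2026-08-15): the exact
mirror-oddness hypothesis is kept verbatim in both conditional stubs (no strengthening to all
macroscopic eigenvectors), so the stubs are not exposed to mirror-even fragments.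

BC3 audit (planner folder `bc/`, 2026-08-17, farm `lean check --json`): this file rc 0, errors [],
sorries 3 = the three `stub_*` theorems (the only `declaration uses sorry` warnings), `#print axioms
OverlapNondegeneracy_of` = [propext, Classical.choice, Quot.sound] (no `sorryAx`). Probes (files
`bc/<Stub>_probe.lean`: route file + the three stub defs only, 12 examples each = {combined
`first | exact? | simpa [S] | (unfold S; simpa) | simpa | aesop`, `exact?`, `simpa [S]`, `(unfold S; simpa)`,
`simpa`, `aesop`} × {`S → OverlapNondegeneracy`, `S → _root_.HubbardSuperconductivity`}, each under
`maxHeartbeats 400000`): for every stub statement `S ∈ {FiniteRangeCapture, NearestNeighbourDominance,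
MirrorOddOrthogonalExtendedS}` ALL 12 FAIL (rc 1; `exact?`: "could not close the goal" / whnf heartbeat
exhaustion, `simpa`: "assumption failed" / heartbeat exhaustion, `aesop`: "failed to prove the goal after
exhaustive search") — 36/36 probes fail: no stub is cheaply the crux or the summit.
-/

noncomputable section

namespace Summit.HubbardSuperconductivity.HubbardSuperconductivity.Cruxes.OverlapNondegeneracy.Birth

open scoped BigOperators Topology Classical Matrix ComplexConjugate
open Filter Set Function
open Literature.Probability.LatticeModels Literature.MathematicalPhysics.QuantumLattice

/-! ## Stub statements -/

/-- **Stub A — finite-range zero-momentum singlet capture (compactness of the Cooper pair).**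
Under the crux hypotheses (`U > 0`, `δ ∈ (0,1/2)`, `FC_T`, `FC_K`, `c > 0`, admissible `(N, ψ)`) there
are a finite displacement set `S ⊂ ℤ²` and `c₁ > 0` such that, eventually in even `L`, every unit
eigenvector `v` of `ρ₂(ψ_L)` with eigenvalue `≥ c N_L`, odd under the diagonal mirror, has
`c₁ L² ≤ Σ_{e ∈ S} ‖⟨v, bond L e⟩‖²`, where `bond L e (o₁, o₂) = ∓ 1/√2` iff `x₂ = x₁ + e (mod L)` with
spins `(↑,↓)` / `(↓,↑)`, else `0` (`‖bond L e‖² = L²`). -/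
def FiniteRangeCapture : Prop :=
  let ET : ∀ (L : ℕ) [NeZero L], ℝ → ℝ → ℝ → ℝ := fun L _ U δ θ =>
    (hubbardTorus 2 L 1 U + ∑ y : ZMod L, ∑ σ : Fin 2, ∑ b : Bool,
      (1 - Complex.exp ((if b then 1 else -1) * Complex.I * θ)) •
        (creation (orb (FermionTorus.ofTorusSite ![if b then 0 else -1, y]) σ) *
          annihilation (orb (FermionTorus.ofTorusSite ![if b then -1 else 0, y]) σ))).minEnergyOn
      (szSector (2 * ⌊(1 - δ) * (L : ℝ) ^ 2 / 2⌋₊) 0);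
  let EK : ∀ (L : ℕ) [NeZero L], ℝ → ℝ → ℝ → ℝ := fun L _ U δ θ =>
    (hamiltonian (SimpleGraph.fromRel fun p q : Lex (Fin (2 * L) × Fin L) =>
        ((ofLex p).1.val + 1 = (ofLex q).1.val ∧ ((ofLex q).2 = (ofLex p).2 ∨ (ofLex q).2 = (ofLex p).2 - 1)) ∨
          ((ofLex p).1.val + 1 = 2 * L ∧ (ofLex q).1.val = 0 ∧
            ((ofLex q).2 = -(ofLex p).2 ∨ (ofLex q).2 = -(ofLex p).2 + 1))) 1 U +
      ∑ p : Lex (Fin (2 * L) × Fin L), ∑ q : Lex (Fin (2 * L) × Fin L), ∑ σ : Fin 2, ∑ b : Bool,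
        (if ((ofLex p).1.val + 1 = 2 * L ∧ (ofLex q).1.val = 0 ∧
            ((ofLex q).2 = -(ofLex p).2 ∨ (ofLex q).2 = -(ofLex p).2 + 1)) then
          (1 - Complex.exp ((if b then 1 else -1) * Complex.I * θ)) •
            (creation (orb (if b then q else p) σ) * annihilation (orb (if b then p else q) σ))
        else 0)).minEnergyOn (szSector (2 * ⌊(1 - δ) * (L : ℝ) ^ 2⌋₊) 0);
  let FCT : ℝ → ℝ → Prop := fun U δ => ∃ ρ : ℝ, 0 < ρ ∧ ∀ᶠ L : ℕ in Filter.atTop, ∀ [NeZero L],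
    Even L → ∀ θ : ℝ, |θ| ≤ Real.pi / 2 → ρ * θ ^ 2 ≤ ET L U δ θ - ET L U δ 0;
  let FCK : ℝ → ℝ → Prop := fun U δ => ∃ κ : ℝ, 0 < κ ∧ ∀ᶠ L : ℕ in Filter.atTop, ∀ [NeZero L],
    Even L → κ ≤ EK L U δ 0 - EK L U δ (Real.pi / 2);
  let Hyp : ℝ → ℝ → (ℕ → ℕ) → (∀ L : ℕ, Fock (Orb (FermionTorus 2 L))) → Prop := fun U δ N ψ =>
    ∀ L, Even L → N L = 2 * ⌊(1 - δ) * (L : ℝ) ^ 2 / 2⌋₊ ∧ star (ψ L) ⬝ᵥ ψ L = 1 ∧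
      IsGroundStateInSector (hubbardTorus 2 L 1 U) (N L) 0 (ψ L);
  let bond : ∀ L : ℕ, Site 2 → Orb (FermionTorus 2 L) × Orb (FermionTorus 2 L) → ℂ := fun L e p =>
    if FermionTorus.toTorusSite (ofLex p.2).1 = FermionTorus.toTorusSite (ofLex p.1).1 + Torus.proj L e then
      (if (ofLex p.1).2 = 0 ∧ (ofLex p.2).2 = 1 then -((1 / Real.sqrt 2 : ℝ) : ℂ)
        else if (ofLex p.1).2 = 1 ∧ (ofLex p.2).2 = 0 then ((1 / Real.sqrt 2 : ℝ) : ℂ) else 0)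
    else 0;
  ∀ U δ : ℝ, 0 < U → δ ∈ Set.Ioo (0 : ℝ) (1 / 2) → FCT U δ → FCK U δ → ∀ c : ℝ, 0 < c →
    ∀ (N : ℕ → ℕ) (ψ : (∀ L : ℕ, Fock (Orb (FermionTorus 2 L)))), Hyp U δ N ψ →
      ∃ S : Finset (Site 2), ∃ c₁ : ℝ, 0 < c₁ ∧ ∀ᶠ L : ℕ in Filter.atTop, ∀ [NeZero L], Even L →
        ∀ (v : Orb (FermionTorus 2 L) × Orb (FermionTorus 2 L) → ℂ) (ev : ℝ), star v ⬝ᵥ v = 1 →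
          Matrix.mulVec (twoParticleRDM (ψ L)) v = (ev : ℂ) • v → c * (N L : ℝ) ≤ ev →
          d4Act (DihedralGroup.sr 3) v = -v →
            c₁ * (L : ℝ) ^ 2 ≤ ∑ e ∈ S, ‖star v ⬝ᵥ bond L e‖ ^ 2

/-- **Stub B — nearest-neighbour shell dominance (the first harmonic is present).** Under the same
hypotheses, for EVERY finite displacement set `S ⊂ ℤ²` there is `c₂ > 0` such that, eventually in even
`L`, every macroscopic mirror-odd unit eigenvector `v` of `ρ₂(ψ_L)` satisfies
`c₂ Σ_{e ∈ S} ‖⟨v, bond L e⟩‖² ≤ ‖⟨v, φ_{s'}⟩‖² + ‖⟨v, φ_d⟩‖²`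
(`φ_{s'} = pairFieldWavefunction extendedSWave L`, `φ_d = pairFieldWavefunction dWaveFormFactor L`:
the nearest-neighbour singlet shell). -/
def NearestNeighbourDominance : Prop :=
  let ET : ∀ (L : ℕ) [NeZero L], ℝ → ℝ → ℝ → ℝ := fun L _ U δ θ =>
    (hubbardTorus 2 L 1 U + ∑ y : ZMod L, ∑ σ : Fin 2, ∑ b : Bool,
      (1 - Complex.exp ((if b then 1 else -1) * Complex.I * θ)) •
        (creation (orb (FermionTorus.ofTorusSite ![if b then 0 else -1, y]) σ) *
          annihilation (orb (FermionTorus.ofTorusSite ![if b then -1 else 0, y]) σ))).minEnergyOn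
      (szSector (2 * ⌊(1 - δ) * (L : ℝ) ^ 2 / 2⌋₊) 0);
  let EK : ∀ (L : ℕ) [NeZero L], ℝ → ℝ → ℝ → ℝ := fun L _ U δ θ =>
    (hamiltonian (SimpleGraph.fromRel fun p q : Lex (Fin (2 * L) × Fin L) =>
        ((ofLex p).1.val + 1 = (ofLex q).1.val ∧ ((ofLex q).2 = (ofLex p).2 ∨ (ofLex q).2 = (ofLex p).2 - 1)) ∨
          ((ofLex p).1.val + 1 = 2 * L ∧ (ofLex q).1.val = 0 ∧
            ((ofLex q).2 = -(ofLex p).2 ∨ (ofLex q).2 = -(ofLex p).2 + 1))) 1 U +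
      ∑ p : Lex (Fin (2 * L) × Fin L), ∑ q : Lex (Fin (2 * L) × Fin L), ∑ σ : Fin 2, ∑ b : Bool,
        (if ((ofLex p).1.val + 1 = 2 * L ∧ (ofLex q).1.val = 0 ∧
            ((ofLex q).2 = -(ofLex p).2 ∨ (ofLex q).2 = -(ofLex p).2 + 1)) then
          (1 - Complex.exp ((if b then 1 else -1) * Complex.I * θ)) •
            (creation (orb (if b then q else p) σ) * annihilation (orb (if b then p else q) σ))
        else 0)).minEnergyOn (szSector (2 * ⌊(1 - δ) * (L : ℝ) ^ 2⌋₊) 0);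
  let FCT : ℝ → ℝ → Prop := fun U δ => ∃ ρ : ℝ, 0 < ρ ∧ ∀ᶠ L : ℕ in Filter.atTop, ∀ [NeZero L],
    Even L → ∀ θ : ℝ, |θ| ≤ Real.pi / 2 → ρ * θ ^ 2 ≤ ET L U δ θ - ET L U δ 0;
  let FCK : ℝ → ℝ → Prop := fun U δ => ∃ κ : ℝ, 0 < κ ∧ ∀ᶠ L : ℕ in Filter.atTop, ∀ [NeZero L],
    Even L → κ ≤ EK L U δ 0 - EK L U δ (Real.pi / 2);
  let Hyp : ℝ → ℝ → (ℕ → ℕ) → (∀ L : ℕ, Fock (Orb (FermionTorus 2 L))) → Prop := fun U δ N ψ =>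
    ∀ L, Even L → N L = 2 * ⌊(1 - δ) * (L : ℝ) ^ 2 / 2⌋₊ ∧ star (ψ L) ⬝ᵥ ψ L = 1 ∧
      IsGroundStateInSector (hubbardTorus 2 L 1 U) (N L) 0 (ψ L);
  let bond : ∀ L : ℕ, Site 2 → Orb (FermionTorus 2 L) × Orb (FermionTorus 2 L) → ℂ := fun L e p =>
    if FermionTorus.toTorusSite (ofLex p.2).1 = FermionTorus.toTorusSite (ofLex p.1).1 + Torus.proj L e then
      (if (ofLex p.1).2 = 0 ∧ (ofLex p.2).2 = 1 then -((1 / Real.sqrt 2 : ℝ) : ℂ)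
        else if (ofLex p.1).2 = 1 ∧ (ofLex p.2).2 = 0 then ((1 / Real.sqrt 2 : ℝ) : ℂ) else 0)
    else 0;
  ∀ U δ : ℝ, 0 < U → δ ∈ Set.Ioo (0 : ℝ) (1 / 2) → FCT U δ → FCK U δ → ∀ c : ℝ, 0 < c →
    ∀ (N : ℕ → ℕ) (ψ : (∀ L : ℕ, Fock (Orb (FermionTorus 2 L)))), Hyp U δ N ψ →
      ∀ S : Finset (Site 2), ∃ c₂ : ℝ, 0 < c₂ ∧ ∀ᶠ L : ℕ in Filter.atTop, ∀ [NeZero L], Even L →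
        ∀ (v : Orb (FermionTorus 2 L) × Orb (FermionTorus 2 L) → ℂ) (ev : ℝ), star v ⬝ᵥ v = 1 →
          Matrix.mulVec (twoParticleRDM (ψ L)) v = (ev : ℂ) • v → c * (N L : ℝ) ≤ ev →
          d4Act (DihedralGroup.sr 3) v = -v →
            c₂ * ∑ e ∈ S, ‖star v ⬝ᵥ bond L e‖ ^ 2 ≤
              ‖star v ⬝ᵥ pairFieldWavefunction extendedSWave L‖ ^ 2 +
                ‖star v ⬝ᵥ pairFieldWavefunction dWaveFormFactor L‖ ^ 2

/-- **Stub C — mirror-odd pair wavefunctions are orthogonal to the extended-`s` pair field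
(angular selection, provable now).** For every side `L ≥ 1` and every pair wavefunction `v` on the
fermionic torus with `d4Act (sr 3) v = -v` (odd under the diagonal mirror `(a,b) ↦ (b,a)`):
`star v ⬝ᵥ pairFieldWavefunction extendedSWave L = 0` (`d4Act` is unitary for `⬝ᵥ` and
`pairFieldWavefunction extendedSWave L` is `D₄`-invariant). -/
def MirrorOddOrthogonalExtendedS : Prop :=
  ∀ (L : ℕ) [NeZero L] (v : Orb (FermionTorus 2 L) × Orb (FermionTorus 2 L) → ℂ),
    d4Act (DihedralGroup.sr 3) v = -v → star v ⬝ᵥ pairFieldWavefunction extendedSWave L = 0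

/-! ## Registered stubs -/

/-- stub A: finite-range zero-momentum singlet capture (hardest stub; open physics). -/
theorem stub_finiteRangeCapture : FiniteRangeCapture := by
  sorry

/-- stub B: nearest-neighbour shell dominance (open physics; necessary condition of the crux). -/
theorem stub_nearestNeighbourDominance : NearestNeighbourDominance := by
  sorry

/-- stub C: mirror-odd ⟂ extended-s (provable now). -/
theorem stub_mirrorOddOrthogonalExtendedS : MirrorOddOrthogonalExtendedS := by
  sorry

/-! ## Name-keyed aliases of the stub statements — the hypotheses of `OverlapNondegeneracy_of`

The native skeleton audit (`#h21_check_skeleton`) admits a hypothesis of the skeleton theorem only if its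
head constant is a registered obligation or is NAMED like a declared stub; `__Registered.stub_X` is the
statement of `stub_X` under that name (device of `AtomisticToContinuum/BoseEinsteinCondensation/Cruxes/
AmplitudeLDP/Lines/birth.lean`). Each alias is `rfl`-equal to its statement. -/
namespace __Registered

/-- Alias of `FiniteRangeCapture` keyed by the registered stub name. -/
abbrev stub_finiteRangeCapture : Prop := FiniteRangeCapture
/-- Alias of `NearestNeighbourDominance` keyed by the registered stub name. -/
abbrev stub_nearestNeighbourDominance : Prop := NearestNeighbourDominance
/-- Alias of `MirrorOddOrthogonalExtendedS` keyed by the registered stub name. -/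
abbrev stub_mirrorOddOrthogonalExtendedS : Prop := MirrorOddOrthogonalExtendedS

end __Registered

/-! ## Composition: the crux BY NAME from the three stub statements (no `sorry` below) -/

/-- **OverlapNondegeneracy_of** — capture (A) × shell dominance (B) × angular selection (C) ⟹ the crux:
`c' := c₁ c₂`; eventually `c₁ c₂ L² ≤ c₂ Σ_{e∈S} ‖⟨v, bond L e⟩‖² ≤ ‖⟨v,φ_{s'}⟩‖² + ‖⟨v,φ_d⟩‖² = ‖⟨v,φ_d⟩‖²`.
Hypotheses = the three stub statements under their registered names; conclusion = the route decl, by name. -/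
theorem OverlapNondegeneracy_of (hA : __Registered.stub_finiteRangeCapture)
    (hB : __Registered.stub_nearestNeighbourDominance)
    (hC : __Registered.stub_mirrorOddOrthogonalExtendedS) :
    Summit.HubbardSuperconductivity.HubbardSuperconductivity.Theses.FluxSpectroscopy.OverlapNondegeneracy := by
  dsimp only [__Registered.stub_finiteRangeCapture, FiniteRangeCapture] at hA
  dsimp only [__Registered.stub_nearestNeighbourDominance, NearestNeighbourDominance] at hB
  dsimp only [__Registered.stub_mirrorOddOrthogonalExtendedS, MirrorOddOrthogonalExtendedS] at hC
  dsimp only [Summit.HubbardSuperconductivity.HubbardSuperconductivity.Theses.FluxSpectroscopy.OverlapNondegeneracy]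
  intro U δ hU hδ hT hK c hc N ψ hyp
  obtain ⟨S, c₁, hc₁, H1⟩ := hA U δ hU hδ hT hK c hc N ψ hyp
  obtain ⟨c₂, hc₂, H2⟩ := hB U δ hU hδ hT hK c hc N ψ hyp S
  refine ⟨c₁ * c₂, mul_pos hc₁ hc₂, ?_⟩
  filter_upwards [H1, H2] with L H1L H2L
  intro inst hLe v ev hv hev hcN hodd
  have a := @H1L inst hLe v ev hv hev hcN hodd
  have b := @H2L inst hLe v ev hv hev hcN hodd
  have h0 : star v ⬝ᵥ pairFieldWavefunction extendedSWave L = 0 := @hC L inst v hodd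
  rw [h0, norm_zero, zero_pow two_ne_zero, zero_add] at b
  calc c₁ * c₂ * (L : ℝ) ^ 2 = c₂ * (c₁ * (L : ℝ) ^ 2) := by ring
    _ ≤ c₂ * _ := mul_le_mul_of_nonneg_left a hc₂.le
    _ ≤ _ := b

end Summit.HubbardSuperconductivity.HubbardSuperconductivity.Cruxes.OverlapNondegeneracy.Birth
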